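import Summits.QuantumFields.YangMills.Theorems.FluctuationComparisonRegPrIntLOrganTangentPullbackSquare
import HarnessLib

/-!
# Crux `FluctuationComparisonRegPrIntL` (stmt-QuantumFields-20520, rung R3), PATH-B organ, v18 (H-currency): BRICK 2a, WINDOWED COARSE LETTERS —
# `secondDiff_pullback_letters_on` (the `_on` edition of ✓p805782 §3, abstract, DEFINITION-FREE)

Cell `ym3-torus` (YM ladder rung R3 = continuum `SU(2)` Yang–Mills on the three-torus — a RUNG: NOT d = 4, NOT infinite volume, NOT a mass gap, NOT Clay).
Width seat `ym3-torus-px19` (gen 19), helper on crux stmt-QuantumFields-20520 (`--kind proof --supports stmt-QuantumFields-20520 --as helper`, count-neutral,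
no registry ∕ binder ∕ `Lines/` edit, default heartbeats, `autoImplicit false`).  All credit for BRICK 2a: LEAD `ym-ust-20520-w3` g25.

WHAT THIS IS.  ✓p805782 `…OrganTangentPullbackSquare` proves the pull-back of a pair clause along displacement paths in two strengths — §2
`secondDiff_pullback` (clause and gradient letters EVERYWHERE) and §2′ `secondDiff_pullback_on` (WINDOWED: clause ∕ gradient letters only at `Good`
configurations with move sizes `≤ ρ`, every grid ∕ correction-prefix configuration `Good`) — but regroups the path sums into the COARSE LETTERS
`k_c B B′ = C·Σ_{a₀ c₀} Xl a₀ B·k a₀ c₀·Xl c₀ B′ + Σ_{d₀} g d₀·Yl d₀ B B′` (§3 `secondDiff_pullback_letters`) only for the unwindowed strength.  The organ's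
H-clauses (`HClauseSq θ r k R`) hold on `PlaqSmall θ` windows only, so the LIN knit needs the WINDOWED coarse letters: THIS FILE is exactly
`secondDiff_pullback_on` + ✓`bilinear_pathSum_le` + ✓`gradient_pathSum_le` (all three 2a's, by name), with 2a §3's conclusion VERBATIM:
★`secondDiff_pullback_letters_on`.  Its row mass is ✓∕⧗ `…OrganTangentPullbackRowMass.rowMass_pullback_letters` (same bracket, α-equal).

HONEST FRAMING: a three-line composition of landed lemmas over HYPOTHESIS clauses; the displacement data are NOT constructed; nothing of Bałaban's analysis
is asserted or proved; LINᵘ-H ∕ JENᵘ-H ∕ O1ᵘ-H v2 ∕ S1aᴴ ∕ 26243 ∕ S2α′ ∕ S2β OPEN; crux 20520 `FluctuationComparisonRegPrIntL` ∕ `YM3TorusSU2` NOT proved; no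
summit ∕ sub-problem statement is proved; rung R3 = SU(2) YM₃ on T³ at fixed lattice data — NOT d = 4, NOT infinite volume, NOT a mass gap, NOT Clay; the
Yang–Mills mass gap is NOT proved.  [folklore] bookkeeping.
-/

set_option autoImplicit false

noncomputable section

namespace Summit.QuantumFields.YangMills.Theorems.OrganTangentPullbackSquareLettersOn

open scoped BigOperators
open Summit.QuantumFields.YangMills.Theorems.OrganTangentPullbackSquare

variable {X ι M Xc ιc Mc : Type*}

/-- ★ **THE WINDOWED COARSE LETTERS**: ✓`secondDiff_pullback_on` (§2′) + the regrouping ✓`bilinear_pathSum_le` ∕ ✓`gradient_pathSum_le` (§3) ⟹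
`|ΔΔ (f ∘ T)| ≤ (C·Σ_{a₀ c₀} Xl a₀ B·k a₀ c₀·Xl c₀ B′ + Σ_{d₀} g d₀·Yl d₀ B B′)·szc m·szc m′` on every coarse square whose displacement data stay in the
window (2a §2′'s hypotheses verbatim) — conclusion = ✓`secondDiff_pullback_letters`' VERBATIM. [folklore] -/
theorem secondDiff_pullback_letters_on [Fintype ι] [DecidableEq ι]
    (Good : X → Prop) (ρ : ℝ) (act : X → ι → M → X) (sz : M → ℝ) (f : X → ℝ) (k : ι → ι → ℝ) (g : ι → ℝ) (C : ℝ)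
    (hk : ∀ a c, 0 ≤ k a c) (hg : ∀ d, 0 ≤ g d) (hsz : ∀ n, 0 ≤ sz n) (hC : 0 ≤ C)
    (actc : Xc → ιc → Mc → Xc) (szc : Mc → ℝ) (T : Xc → X)
    (E : Xc → ιc → Mc → List (ι × M)) (Corr : Xc → ιc → Mc → ιc → Mc → List (ι × M))
    (Xl : ι → ιc → ℝ) (Yl : ι → ιc → ιc → ℝ)
    (hT2 : ∀ (Y : X) (P Q : List (ι × M)),
      (∀ a ∈ P, C * sz a.2 ≤ ρ) → (∀ c ∈ Q, sz c.2 ≤ ρ) →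
      (∀ i l, i ≤ P.length → l ≤ Q.length →
        Good ((Q.take l).foldl (fun V p => act V p.1 p.2) ((P.take i).foldl (fun V p => act V p.1 p.2) Y))) →
      |f (Q.foldl (fun V p => act V p.1 p.2) (P.foldl (fun V p => act V p.1 p.2) Y)) - f (P.foldl (fun V p => act V p.1 p.2) Y)
          - f (Q.foldl (fun V p => act V p.1 p.2) Y) + f Y|
        ≤ C * (P.map (fun a => (Q.map (fun c => k a.1 c.1 * sz a.2 * sz c.2)).sum)).sum)
    (hG : ∀ (Y : X) (b : ι) (n : M), Good Y → sz n ≤ ρ → |f (act Y b n) - f Y| ≤ g b * sz n)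
    (hE : ∀ (V : Xc) (B : ιc) (m : Mc), (E V B m).foldl (fun V p => act V p.1 p.2) (T V) = T (actc V B m))
    (hCorr : ∀ (V : Xc) (B : ιc) (m : Mc) (B' : ιc) (m' : Mc),
      (Corr V B m B' m').foldl (fun V p => act V p.1 p.2)
          ((E V B' m').foldl (fun V p => act V p.1 p.2) ((E V B m).foldl (fun V p => act V p.1 p.2) (T V))) =
        T (actc (actc V B m) B' m'))
    (hX : ∀ (V : Xc) (B : ιc) (m : Mc) (a₀ : ι),
      (((E V B m).filter (fun p => decide (p.1 = a₀))).map (fun p => sz p.2)).sum ≤ Xl a₀ B * szc m)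
    (hY : ∀ (V : Xc) (B : ιc) (m : Mc) (B' : ιc) (m' : Mc) (d₀ : ι),
      (((Corr V B m B' m').filter (fun p => decide (p.1 = d₀))).map (fun p => sz p.2)).sum ≤ Yl d₀ B B' * szc m * szc m')
    (V : Xc) (B B' : ιc) (m m' : Mc)
    (hszP : ∀ a ∈ E V B m, C * sz a.2 ≤ ρ) (hszQ : ∀ c ∈ E V B' m', sz c.2 ≤ ρ) (hszC : ∀ d ∈ Corr V B m B' m', sz d.2 ≤ ρ)
    (hgrid : ∀ i l, i ≤ (E V B m).length → l ≤ (E V B' m').length →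
      Good (((E V B' m').take l).foldl (fun V p => act V p.1 p.2) (((E V B m).take i).foldl (fun V p => act V p.1 p.2) (T V))))
    (hcorr : ∀ i, i < (Corr V B m B' m').length →
      Good (((Corr V B m B' m').take i).foldl (fun V p => act V p.1 p.2)
        ((E V B' m').foldl (fun V p => act V p.1 p.2) ((E V B m).foldl (fun V p => act V p.1 p.2) (T V))))) :
    |f (T (actc (actc V B m) B' m')) - f (T (actc V B m)) - f (T (actc V B' m')) + f (T V)|
      ≤ (C * ∑ a₀ : ι, ∑ c₀ : ι, Xl a₀ B * k a₀ c₀ * Xl c₀ B' + ∑ d₀ : ι, g d₀ * Yl d₀ B B') * szc m * szc m' := by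
  have h := secondDiff_pullback_on Good ρ act sz f k g C actc T E Corr hT2 hG hE hCorr V B B' m m' hszP hszQ hszC hgrid hcorr
  have hb := bilinear_pathSum_le sz k hk hsz (E V B m) (E V B' m') (fun a₀ => Xl a₀ B * szc m) (fun c₀ => Xl c₀ B' * szc m')
    (hX V B m) (hX V B' m')
  have hc := gradient_pathSum_le sz g hg (Corr V B m B' m') (fun d₀ => Yl d₀ B B' * szc m * szc m') (hY V B m B' m')
  have e1 : ∑ a₀ : ι, ∑ c₀ : ι, k a₀ c₀ * (Xl a₀ B * szc m) * (Xl c₀ B' * szc m')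
      = (∑ a₀ : ι, ∑ c₀ : ι, Xl a₀ B * k a₀ c₀ * Xl c₀ B') * szc m * szc m' := by
    rw [Finset.sum_mul, Finset.sum_mul]
    refine Finset.sum_congr rfl (fun a₀ _ => ?_)
    rw [Finset.sum_mul, Finset.sum_mul]
    exact Finset.sum_congr rfl (fun c₀ _ => by ring)
  have e2 : ∑ d₀ : ι, g d₀ * (Yl d₀ B B' * szc m * szc m') = (∑ d₀ : ι, g d₀ * Yl d₀ B B') * szc m * szc m' := by
    rw [Finset.sum_mul, Finset.sum_mul]
    exact Finset.sum_congr rfl (fun d₀ _ => by ring)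
  rw [e1] at hb
  rw [e2] at hc
  calc |f (T (actc (actc V B m) B' m')) - f (T (actc V B m)) - f (T (actc V B' m')) + f (T V)|
      ≤ C * ((E V B m).map (fun a => ((E V B' m').map (fun c => k a.1 c.1 * sz a.2 * sz c.2)).sum)).sum
          + ((Corr V B m B' m').map (fun p => g p.1 * sz p.2)).sum := h
    _ ≤ C * ((∑ a₀ : ι, ∑ c₀ : ι, Xl a₀ B * k a₀ c₀ * Xl c₀ B') * szc m * szc m')
          + (∑ d₀ : ι, g d₀ * Yl d₀ B B') * szc m * szc m' := add_le_add (mul_le_mul_of_nonneg_left hb hC) hc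
    _ = (C * ∑ a₀ : ι, ∑ c₀ : ι, Xl a₀ B * k a₀ c₀ * Xl c₀ B' + ∑ d₀ : ι, g d₀ * Yl d₀ B B') * szc m * szc m' := by ring

/-- The windowed coarse letters with the column letters assumed only where they are used (per `V B m`) and the conclusion restated as a bound by
any `kc ≥` the bracket — the shape a clause consumer quantifies (`|ΔΔ| ≤ kc B B′·szc m·szc m′`). [folklore] -/
theorem secondDiff_pullback_le_of_letters_on [Fintype ι] [DecidableEq ι]
    (Good : X → Prop) (ρ : ℝ) (act : X → ι → M → X) (sz : M → ℝ) (f : X → ℝ) (k : ι → ι → ℝ) (g : ι → ℝ) (C : ℝ)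
    (hk : ∀ a c, 0 ≤ k a c) (hg : ∀ d, 0 ≤ g d) (hsz : ∀ n, 0 ≤ sz n) (hC : 0 ≤ C)
    (actc : Xc → ιc → Mc → Xc) (szc : Mc → ℝ) (hszc : ∀ m, 0 ≤ szc m) (T : Xc → X)
    (E : Xc → ιc → Mc → List (ι × M)) (Corr : Xc → ιc → Mc → ιc → Mc → List (ι × M))
    (Xl : ι → ιc → ℝ) (Yl : ι → ιc → ιc → ℝ) (kc : ιc → ιc → ℝ)
    (hkc : ∀ B B', C * ∑ a₀ : ι, ∑ c₀ : ι, Xl a₀ B * k a₀ c₀ * Xl c₀ B' + ∑ d₀ : ι, g d₀ * Yl d₀ B B' ≤ kc B B')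
    (hT2 : ∀ (Y : X) (P Q : List (ι × M)),
      (∀ a ∈ P, C * sz a.2 ≤ ρ) → (∀ c ∈ Q, sz c.2 ≤ ρ) →
      (∀ i l, i ≤ P.length → l ≤ Q.length →
        Good ((Q.take l).foldl (fun V p => act V p.1 p.2) ((P.take i).foldl (fun V p => act V p.1 p.2) Y))) →
      |f (Q.foldl (fun V p => act V p.1 p.2) (P.foldl (fun V p => act V p.1 p.2) Y)) - f (P.foldl (fun V p => act V p.1 p.2) Y)
          - f (Q.foldl (fun V p => act V p.1 p.2) Y) + f Y|
        ≤ C * (P.map (fun a => (Q.map (fun c => k a.1 c.1 * sz a.2 * sz c.2)).sum)).sum)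
    (hG : ∀ (Y : X) (b : ι) (n : M), Good Y → sz n ≤ ρ → |f (act Y b n) - f Y| ≤ g b * sz n)
    (hE : ∀ (V : Xc) (B : ιc) (m : Mc), (E V B m).foldl (fun V p => act V p.1 p.2) (T V) = T (actc V B m))
    (hCorr : ∀ (V : Xc) (B : ιc) (m : Mc) (B' : ιc) (m' : Mc),
      (Corr V B m B' m').foldl (fun V p => act V p.1 p.2)
          ((E V B' m').foldl (fun V p => act V p.1 p.2) ((E V B m).foldl (fun V p => act V p.1 p.2) (T V))) =
        T (actc (actc V B m) B' m'))
    (hX : ∀ (V : Xc) (B : ιc) (m : Mc) (a₀ : ι),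
      (((E V B m).filter (fun p => decide (p.1 = a₀))).map (fun p => sz p.2)).sum ≤ Xl a₀ B * szc m)
    (hY : ∀ (V : Xc) (B : ιc) (m : Mc) (B' : ιc) (m' : Mc) (d₀ : ι),
      (((Corr V B m B' m').filter (fun p => decide (p.1 = d₀))).map (fun p => sz p.2)).sum ≤ Yl d₀ B B' * szc m * szc m')
    (V : Xc) (B B' : ιc) (m m' : Mc)
    (hszP : ∀ a ∈ E V B m, C * sz a.2 ≤ ρ) (hszQ : ∀ c ∈ E V B' m', sz c.2 ≤ ρ) (hszC : ∀ d ∈ Corr V B m B' m', sz d.2 ≤ ρ)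
    (hgrid : ∀ i l, i ≤ (E V B m).length → l ≤ (E V B' m').length →
      Good (((E V B' m').take l).foldl (fun V p => act V p.1 p.2) (((E V B m).take i).foldl (fun V p => act V p.1 p.2) (T V))))
    (hcorr : ∀ i, i < (Corr V B m B' m').length →
      Good (((Corr V B m B' m').take i).foldl (fun V p => act V p.1 p.2)
        ((E V B' m').foldl (fun V p => act V p.1 p.2) ((E V B m).foldl (fun V p => act V p.1 p.2) (T V))))) :
    |f (T (actc (actc V B m) B' m')) - f (T (actc V B m)) - f (T (actc V B' m')) + f (T V)| ≤ kc B B' * szc m * szc m' := by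
  have h := secondDiff_pullback_letters_on Good ρ act sz f k g C hk hg hsz hC actc szc T E Corr Xl Yl hT2 hG hE hCorr hX hY
    V B B' m m' hszP hszQ hszC hgrid hcorr
  refine h.trans ?_
  have hmm : 0 ≤ szc m * szc m' := mul_nonneg (hszc m) (hszc m')
  calc (C * ∑ a₀ : ι, ∑ c₀ : ι, Xl a₀ B * k a₀ c₀ * Xl c₀ B' + ∑ d₀ : ι, g d₀ * Yl d₀ B B') * szc m * szc m'
      = (C * ∑ a₀ : ι, ∑ c₀ : ι, Xl a₀ B * k a₀ c₀ * Xl c₀ B' + ∑ d₀ : ι, g d₀ * Yl d₀ B B') * (szc m * szc m') := by ring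
    _ ≤ kc B B' * (szc m * szc m') := mul_le_mul_of_nonneg_right (hkc B B') hmm
    _ = kc B B' * szc m * szc m' := by ring

end Summit.QuantumFields.YangMills.Theorems.OrganTangentPullbackSquareLettersOn

end
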